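import Summits.Ventures.PercRepro.PuncturedLYMCoHypDeletion
import Summits.Ventures.PercRepro.PuncturedLYMTwoHyperplane

/-!
# PercRepro — TWO HYPERPLANES OF A PAVING MATROID MEET IN AT MOST `r − 2` POINTS (p10, gen 35)

The intersection condition `#(H₁ ∩ H₂) ≤ r − 2` of `IsTwoHyperplaneF` is AUTOMATIC: if the dependent `r`-sets of a
paving matroid of rank `r ≥ 2` are the `r`-subsets of `H₁` or of `H₂`, neither containing the other, and
`#(H₁ ∩ H₂) ≥ r − 1`, take `T ⊆ H₁ ∩ H₂` with `r − 1` points, `x ∈ H₁ ∖ H₂`, `y ∈ H₂ ∖ H₁`: `T ∪ x ⊆ H₁` and `T ∪ y ⊆ H₂`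
are dependent `r`-sets of rank `r − 1`, so by submodularity `rk(T ∪ {x, y}) ≤ r − 1`, while `T ∪ {x, y}` contains the
`r`-set `(T ∖ t) ∪ {x, y}`, which lies in neither `H₁` nor `H₂` and is therefore independent — a contradiction
(`card_inter_add_two_le_of_dep_twoHyperplane`).  Hence:
* `isTwoHyperplaneF_of_cover` — the predicate from the cover `H₁ ∪ H₂ = gr M`, properness and `r ≤ #H_i` alone;
* **`normConsAt_of_twoHyperplane'`** — (NC) for every paving matroid of rank `r ≥ 2` with `r + 1 ≤ n ≤ 2r − 2` whose
  dependent `r`-sets are the `r`-subsets of two proper subsets `H₁, H₂` of size `≥ r` covering the ground set.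
Nothing here asserts (SP), (PAV) or (NC) in general.
-/

open scoped Matroid

namespace PercRepro.Cogirth

open Finset ThmH Skew

variable {α : Type} [DecidableEq α] {M : Matroid α} [M.Finite]

/-- **Two hyperplanes of a paving matroid of rank `r ≥ 2` meet in at most `r − 2` points**: if the dependent `r`-sets
are the `r`-subsets of `H₁` or of `H₂` and neither contains the other, then `#(H₁ ∩ H₂) + 2 ≤ r`. -/
theorem card_inter_add_two_le_of_dep_twoHyperplane {r : ℕ} (hrk : rk M (gr M) = r) (hp : IsPaving M) (hr : 2 ≤ r)
    {H₁ H₂ : Finset α} (h1g : H₁ ⊆ gr M) (h2g : H₂ ⊆ gr M) (h12 : ¬ H₁ ⊆ H₂) (h21 : ¬ H₂ ⊆ H₁)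
    (hH : ∀ S ⊆ gr M, S.card = r → (rk M S ≠ S.card ↔ S ⊆ H₁ ∨ S ⊆ H₂)) : (H₁ ∩ H₂).card + 2 ≤ r := by
  by_contra hcon
  obtain ⟨T, hT, hTc⟩ := exists_subset_card_eq (show r - 1 ≤ (H₁ ∩ H₂).card by omega)
  obtain ⟨x, hx1, hx2⟩ := not_subset.1 h12
  obtain ⟨y, hy2, hy1⟩ := not_subset.1 h21
  have hT1 : T ⊆ H₁ := hT.trans inter_subset_left
  have hT2 : T ⊆ H₂ := hT.trans inter_subset_right
  have hxT : x ∉ T := fun h => hx2 (hT2 h)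
  have hyT : y ∉ T := fun h => hy1 (hT1 h)
  have hxy : x ≠ y := fun h => hx2 (h ▸ hy2)
  have hTg : T ⊆ gr M := hT1.trans h1g
  -- `T` is independent (paving)
  have hTi : rk M T = T.card := hp T hTg (by rw [hTc, hrk]; omega)
  -- `A = T ∪ x ⊆ H₁` and `B = T ∪ y ⊆ H₂` are dependent `r`-sets of rank `r − 1`
  have hAc : (insert x T).card = r := by rw [card_insert_of_notMem hxT, hTc]; omega
  have hBc : (insert y T).card = r := by rw [card_insert_of_notMem hyT, hTc]; omega
  have hAg : insert x T ⊆ gr M := insert_subset (h1g hx1) hTg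
  have hBg : insert y T ⊆ gr M := insert_subset (h2g hy2) hTg
  have hAdep : rk M (insert x T) ≠ (insert x T).card :=
    (hH _ hAg hAc).2 (Or.inl (insert_subset hx1 hT1))
  have hBdep : rk M (insert y T) ≠ (insert y T).card :=
    (hH _ hBg hBc).2 (Or.inr (insert_subset hy2 hT2))
  have hAle := rk_le_card (M := M) (insert x T)
  have hBle := rk_le_card (M := M) (insert y T)
  have hAge : rk M T ≤ rk M (insert x T) := rk_mono_of_subset (subset_insert x T)
  have hBge : rk M T ≤ rk M (insert y T) := rk_mono_of_subset (subset_insert y T)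
  -- `A ∩ B = T`
  have hAB : insert x T ∩ insert y T = T := by
    ext z
    simp only [mem_inter, mem_insert]
    constructor
    · rintro ⟨h1 | h1, h2 | h2⟩
      · exact absurd (h1.symm.trans h2) hxy
      · exact h2
      · exact h1
      · exact h1
    · intro h
      exact ⟨Or.inr h, Or.inr h⟩
  -- submodularity: `rk(A ∪ B) ≤ r − 1`
  have hsub := rk_union_add_rk_inter_le (M := M) (insert x T) (insert y T)
  rw [hAB] at hsub
  -- the `r`-set `S = (T ∖ t) ∪ {x, y}` inside `A ∪ B` is independent
  have hTne : T.Nonempty := by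
    rw [← card_pos, hTc]
    omega
  obtain ⟨t, ht⟩ := hTne
  have hyT' : y ∉ T.erase t := fun h => hyT (erase_subset t T h)
  have hxT' : x ∉ insert y (T.erase t) := by
    rw [mem_insert]
    rintro (h | h)
    · exact hxy h
    · exact hxT (erase_subset t T h)
  have hSc : (insert x (insert y (T.erase t))).card = r := by
    rw [card_insert_of_notMem hxT', card_insert_of_notMem hyT', card_erase_of_mem ht, hTc]
    omega
  have hSsub : insert x (insert y (T.erase t)) ⊆ insert x T ∪ insert y T := by
    intro z hz
    rw [mem_insert, mem_insert] at hz
    rw [mem_union, mem_insert, mem_insert]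
    rcases hz with h | h | h
    · exact Or.inl (Or.inl h)
    · exact Or.inr (Or.inl h)
    · exact Or.inl (Or.inr (erase_subset t T h))
  have hSg : insert x (insert y (T.erase t)) ⊆ gr M := hSsub.trans (union_subset hAg hBg)
  have hSi : rk M (insert x (insert y (T.erase t))) = (insert x (insert y (T.erase t))).card := by
    by_contra hne
    rcases (hH _ hSg hSc).1 hne with h | h
    · exact hy1 (h (mem_insert_of_mem (mem_insert_self y _)))
    · exact hx2 (h (mem_insert_self x _))
  have := rk_mono_of_subset (M := M) hSsub
  omega

/-- The two-hyperplane predicate from the cover, properness and `r ≤ #H_i` alone (`r ≥ 2`): neither hyperplane contains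
the other (else the cover would make it the whole ground set), so their intersection has at most `r − 2` points. -/
theorem isTwoHyperplaneF_of_cover {r : ℕ} (hrk : rk M (gr M) = r) (hp : IsPaving M) (hr : 2 ≤ r) {H₁ H₂ : Finset α}
    (h1g : H₁ ⊆ gr M) (h2g : H₂ ⊆ gr M) (hcover : H₁ ∪ H₂ = gr M) (h1n : H₁.card < (gr M).card)
    (h2n : H₂.card < (gr M).card) (hr1 : r ≤ H₁.card) (hr2 : r ≤ H₂.card)
    (hH : ∀ S ⊆ gr M, S.card = r → (rk M S ≠ S.card ↔ S ⊆ H₁ ∨ S ⊆ H₂)) : IsTwoHyperplaneF M r H₁ H₂ := by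
  have h12 : ¬ H₁ ⊆ H₂ := by
    intro h
    have : H₁ ∪ H₂ = H₂ := union_eq_right.2 h
    rw [this] at hcover
    rw [hcover] at h2n
    exact lt_irrefl _ h2n
  have h21 : ¬ H₂ ⊆ H₁ := by
    intro h
    have : H₁ ∪ H₂ = H₁ := union_eq_left.2 h
    rw [this] at hcover
    rw [hcover] at h1n
    exact lt_irrefl _ h1n
  exact ⟨hrk, hp, h1g, h2g, hcover, h1n, h2n, hr1, hr2,
    card_inter_add_two_le_of_dep_twoHyperplane hrk hp hr h1g h2g h12 h21 hH, hH⟩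

/-- **(NC) FOR EVERY PAVING MATROID OF RANK `r ≥ 2` WHOSE DEPENDENT `r`-SETS ARE THE `r`-SUBSETS OF TWO PROPER SUBSETS
`H₁, H₂` OF SIZE `≥ r` COVERING THE GROUND SET**, with `r + 1 ≤ n ≤ 2r − 2` (no intersection hypothesis). -/
theorem normConsAt_of_twoHyperplane' {r : ℕ} (hrk : rk M (gr M) = r) (hp : IsPaving M) (hr : 2 ≤ r)
    {H₁ H₂ : Finset α} (h1g : H₁ ⊆ gr M) (h2g : H₂ ⊆ gr M) (hcover : H₁ ∪ H₂ = gr M)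
    (h1n : H₁.card < (gr M).card) (h2n : H₂.card < (gr M).card) (hr1 : r ≤ H₁.card) (hr2 : r ≤ H₂.card)
    (hH : ∀ S ⊆ gr M, S.card = r → (rk M S ≠ S.card ↔ S ⊆ H₁ ∨ S ⊆ H₂)) (hr1n : r + 1 ≤ (gr M).card)
    (hn : (gr M).card + 2 ≤ 2 * r) : NormConsAt M :=
  normConsAt_of_twoHyperplane (isTwoHyperplaneF_of_cover hrk hp hr h1g h2g hcover h1n h2n hr1 hr2 hH) hr1n hn

end PercRepro.Cogirth
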